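/-
Copyright (c) 2026 the pub-hodgecm-mathlib formalisation cell (harness21).  Prover seat hodgecm-mathlib-K2Liu-p12 (g3): Track B «K2-LIT»,
#184♮ = hLiu418 = stmt-HodgeConjecture-24832; Road Φ of socket #41, Φ9 consumer sheet row G1 = organ Φ3d HEAD (K2E5-plan (g7) deal (b′) 2026-09-04T11:53:45Z;
census `K2/K2Liu-p12/g3/CENSUS-G1-WhittakerDeltaEulerHead.K2Liu-p12-g3.md`, file (d3)).
-/
import Summits.HodgeConjecture.HodgeConjecture.Theorems.K2LiuSiegelUnipotentEulerProduct    -- ★ Φ3c `integral_unipDelta_eq_mul_tprod` (+ Φ3b pinned splitting, DEFS leaves)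
import Summits.HodgeConjecture.HodgeConjecture.Theorems.K2LiuSiegelUnipotentFourierDefs      -- ★ Φ1 DEFS `unipDeltaChar`, `whittakerDelta`
import Literature.NumberTheory.K2Lit.LocalDoublingUnramifiedHecke                            -- ★ `IsFactorizableOff`, `LambdaLoc` (spherical local sections)
import HarnessLib

/-!
# Crux `HLiu418`, Road Φ of socket #41, organ Φ3d — THE EULER HEAD OF THE TWISTED BIG-CELL INTEGRAL (sheet row G1), hypothesis-first:
# `W_S(f_s)(h) = W_{S,T}(s)(h_∞, h_T) · ∏'_{v∉T} W°_{S,v}(s)`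

Cell `hodgecm-mathlib`, crux item hLiu418 = `stmt-HodgeConjecture-24832`, route of record `HCCMUnconditional`; squad K2 ∕ K2Liu, road `K2_Liu`,
socket #41 `sig_K2LiuSiegelEisensteinContinuation`, Road Φ; Φ9 consumer sheet row G1 (face «`whittakerDelta νN S (f s) h = W_{S,T}(s)(h_∞,h_T) ·
∏'_{v∉T} W°_{S,v}(s)(h_v)` on `re s > n∕2`, `T ⊇ T₀(𝒦,f,h_f)` finite, spherical local factors off `T`»).  THEOREMS ONLY (no `def`, no `instance`, no
`notation`, no named-fact hypothesis, no `sorry`); lane `--supports stmt-HodgeConjecture-24832` (count-neutral helper; closes no socket by itself).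

THE MATHEMATICS.  `W_S(f)(h) = ∫_{N_Δ(𝔸)} conj ψ_S(u) · f(w_Δ u h) dνN(u)` (★ Φ1 `whittakerDelta`).  For a section family `f` FACTORIZABLE OFF `T`
(★ #31s `stdFamilyFactorisable` ⇒ ★ K2Lit `IsFactorizableOff T χ f fT`: `f_s(x) = fT_s(x_∞, x_T) · ∏ᶠ_{v∉T} Λ_{s,v}(x_v)`, `Λ_{s,v}` the `K_{H,v}`-spherical
local section ★ `LambdaLoc`), a point `h` with `h_v ∈ K_{H,v}` off `T`, `w_{Δ,v} ∈ K_{H,v}` off `T`, and the unipotent character factorised place by place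
BY VALUE — `conj ψ_S(u) = ΨT(u_∞, u_T) · ∏ᶠ_{v∉T} Ψ_v(u_v)` with `Ψ_v ≡ 1` on `K_{H,v} ∩ N_Δ(L⁺_v)` off `T` (file (d1) `K2LiuSiegelUnipotentCharacterFactorisation`
discharges it), and the section side read in the split coordinates BY VALUE — `f_s(w_Δ u h) = FT(u_∞, u_T) · ∏ᶠ_{v∉T} Λ_v(u_v)` with `Λ_v ≡ 1` on
`K_{H,v} ∩ N_Δ(L⁺_v)` off `T` (file (d2) `K2LiuWhittakerDeltaIntegrandFactorisation` discharges it from `IsFactorizableOff`: `Λ_v(y) = Λ_{s,v}(w_Δ y)`,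
`Λ_{s,v}(w_Δ y h_v) = Λ_{s,v}(w_Δ y)` by right `K_{H,v}`-invariance ★ `lambdaLoc_mul_localInt`, `= 1` on `K_{H,v} ∩ N_Δ` ★ `lambdaLoc_of_mem_localInt`) — the integrand
`G(u) = conj ψ_S(u) · f_s(w_Δ u h)` has the shape (F) of ★ Φ3c `integral_unipDelta_eq_mul_tprod`: `G(u) = [ΨT·FT](u_∞, u_T) · ∏ᶠ_{v∉T} Ψ_v(u_v) Λ_v(u_v)`, the local
factor `≡ 1` on `K_{H,v} ∩ N_Δ` off `T`.  Hence, for `G ∈ L¹(νN)` (★ O41.3 `intertwiningConverges` on `re s > n∕2`, the character being unimodular),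
* §1 `whittakerIntegrand_eq_mul_finprod` — the shape (F) (Mathlib `finprod_mul_distrib`; finite supports from `u_v ∈ K_{H,v}` for almost all `v`), and
  `whittakerLocIntegrand_eq_one_of_mem` — the local integrand is `1` on `K_{H,v} ∩ N_Δ(L⁺_v)` off `T`;
* §2 **`whittakerDelta_eq_mul_tprod`** — `W_S(f_s)(h) = (∫ ΨT · FT d(ν_∞ ⊗ ⊗_{v∈T} ν_v)) · ∏'_{v∉T} ∫_{N_Δ(L⁺_v)} Ψ_v(y) Λ_v(y) dν_v(y)`
  — the sheet's row-G1 face with the SPHERICAL local Whittaker coefficient `W°_{S,v}(s) := ∫ conj ψ_{S,v}(y) Λ_{s,v}(w_Δ y) dν_v(y)` as the explicit local integral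
  (no new `def`; its VALUE at a good unimodular place is ★ E5∕E7, its Euler product over good places is ★ `K2LiuGoodPlaceWhittakerEulerAssembly`), plus the
  integrability of the transported integrand (Φ3c's first conjunct) for the Φ9 bookkeeping.
Letters: the measure letters `(νN) (νv) (hνK) (νinf) (hmap)` are ★ Φ3c's VERBATIM (`hmap` = ★ Φ3b `exists_isHaarMeasure_map_unipDeltaSplit_eq_prod_pi_rpMeasure`).
HONEST LABEL.  Count-neutral helper; it retires nothing by itself: `HC_CM` is proved only modulo the 7 printed citations (2 remaining named inputs:
hLiu418 = `stmt-HodgeConjecture-24832`, h413 = `stmt-HodgeConjecture-24833`) until rung 0 closes.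

## References
* [KudlaRallis1994] S. Kudla, S. Rallis, Ann. of Math. 140 (1994): §1–§2 (Euler product of the Fourier coefficients of Siegel Eisenstein series for factorizable sections).
* [Tan1999] V. Tan, Canad. J. Math. 51 (1999): §2–§3 (`W_β = ⊗_v W_{β,v}` on `U(n,n)`).
* [Shimura1997] G. Shimura, *Euler Products and Eisenstein Series*, CBMS 93 (1997): §18.3.
* [CasselsFrohlichANT1967] Cassels–Fröhlich (eds.), *Algebraic Number Theory* (1967): Ch. XV (Tate) §3.3 Thm. 3.3.1.
* [BorelJacquet1979] A. Borel, H. Jacquet, PSPM 33.1 (1979): §4.1 (restricted tensor products).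
-/

set_option autoImplicit false
-- the mandated namespace repeats the single-problem summit's segment (`HodgeConjecture.HodgeConjecture`)
set_option linter.dupNamespace false

noncomputable section

open scoped Matrix RestrictedProduct ENNReal NNReal Topology ComplexConjugate
open NumberField IsDedekindDomain MeasureTheory Measure Filter Set

namespace Summit.HodgeConjecture.HodgeConjecture.Cruxes.HLiu418.K2LiuWhittakerDeltaEulerHead

open Literature.NumberTheory.Automorphic Literature.NumberTheory.GaloisRepresentations
open Literature.NumberTheory.GelbartRogawski1991 Literature.NumberTheory.GelbartRogawski1991.GRConstruction
open Literature.NumberTheory.K2Lit.SiegelDoubled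
open Literature.NumberTheory.K2Lit.PlaceSplitting
open Literature.MeasureTheory.RestrictedProduct
open Literature.Topology.Algebra.RestrictedProduct (inH)
open Summit.HodgeConjecture.HodgeConjecture.Cruxes.HLiu418.K2LiuSiegelUnipotentLocalDefs
open Summit.HodgeConjecture.HodgeConjecture.Cruxes.HLiu418.K2LiuSiegelUnipotentSplitDefs
open Summit.HodgeConjecture.HodgeConjecture.Cruxes.HLiu418.K2LiuSiegelUnipotentSplitAtDefs
open Summit.HodgeConjecture.HodgeConjecture.Cruxes.HLiu418.K2LiuSiegelUnipotentHaarPinned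
open Summit.HodgeConjecture.HodgeConjecture.Cruxes.HLiu418.K2LiuSiegelUnipotentEulerProduct
open Summit.HodgeConjecture.HodgeConjecture.Cruxes.HLiu418.K2LiuSiegelUnipotentFourierDefs

variable (L : Type) [Field L] [NumberField L] [IsCMField L]
variable {N M n : ℕ} (e : Fin N × Fin M ≃ Fin n)
  (dV : Fin N → L) (hdV : ∀ i, IsCMField.complexConj L (dV i) = dV i)
  (dW : Fin M → L) (hdW : ∀ i, IsCMField.complexConj L (dW i) = dW i)
  (T : Finset (HeightOneSpectrum (𝓞 (Fp L)))) [DecidableEq (HeightOneSpectrum (𝓞 (Fp L)))]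

variable [MeasurableSpace ↥(unipDelta L e dV hdV dW hdW)] [BorelSpace ↥(unipDelta L e dV hdV dW hdW)]
  [MeasurableSpace ↥(unipDeltaArch L e dV hdV dW hdW)] [BorelSpace ↥(unipDeltaArch L e dV hdV dW hdW)]
  [∀ v : HeightOneSpectrum (𝓞 (Fp L)), MeasurableSpace ↥(unipDeltaLoc L e dV hdV dW hdW v)] [∀ v : HeightOneSpectrum (𝓞 (Fp L)), BorelSpace ↥(unipDeltaLoc L e dV hdV dW hdW v)]

/-! ## §1 The shape (F) of the twisted big-cell integrand from the two by-value factorisations -/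

omit [DecidableEq (HeightOneSpectrum (𝓞 (Fp L)))] [MeasurableSpace ↥(unipDelta L e dV hdV dW hdW)] [BorelSpace ↥(unipDelta L e dV hdV dW hdW)]
  [MeasurableSpace ↥(unipDeltaArch L e dV hdV dW hdW)] [BorelSpace ↥(unipDeltaArch L e dV hdV dW hdW)]
  [∀ v : HeightOneSpectrum (𝓞 (Fp L)), MeasurableSpace ↥(unipDeltaLoc L e dV hdV dW hdW v)] [∀ v : HeightOneSpectrum (𝓞 (Fp L)), BorelSpace ↥(unipDeltaLoc L e dV hdV dW hdW v)] in
/-- **THE SHAPE (F) OF `u ↦ conj ψ_S(u) · f_s(w_Δ u h)`** from the two factorisations BY VALUE: the character side `conj ψ_S(u) = ΨT(u_∞,u_T)·∏ᶠ_{v∉T} Ψ_v(u_v)`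
(file (d1)) and the section side `f_s(w_Δ u h) = FT(u_∞,u_T)·∏ᶠ_{v∉T} Λ_v(u_v)` (file (d2): ★ #31s `IsFactorizableOff` at `w_Δ u h`, `Λ_v(y) = Λ_{s,v}(w_Δ y)`), both
restricted tensor factors `≡ 1` on `K_{H,v} ∩ N_Δ(L⁺_v)` off `T` (so of finite support at every `u ∈ N_Δ(𝔸)`: `u_v ∈ K_{H,v}` for almost all `v`):
`conj ψ_S(u) · f_s(w_Δ u h) = [ΨT · FT](u_∞,u_T) · ∏ᶠ_{v∉T} Ψ_v(u_v) Λ_v(u_v)` (Mathlib `finprod_mul_distrib`). [cite: KudlaRallis1994, §1] [cite: BorelJacquet1979, §4.1] -/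
theorem whittakerIntegrand_eq_mul_finprod {f : ℂ → HA L e dV hdV dW hdW → ℂ} (s : ℂ) (S : Matrix (Fin n) (Fin n) L) (h : HA L e dV hdV dW hdW)
    {ΨT FT : ↥(unipDeltaArch L e dV hdV dW hdW) × (Π v : T, ↥(unipDeltaLoc L e dV hdV dW hdW v.1)) → ℂ}
    {Ψv Λv : ∀ v : HeightOneSpectrum (𝓞 (Fp L)), ↥(unipDeltaLoc L e dV hdV dW hdW v) → ℂ}
    (hψ : ∀ u : ↥(unipDelta L e dV hdV dW hdW), conj (unipDeltaChar L e dV hdV dW hdW S (u : HA L e dV hdV dW hdW) : ℂ) =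
      ΨT ((unipDeltaSplit L e dV hdV dW hdW u).1, fun v : T => (unipDeltaSplit L e dV hdV dW hdW u).2 v.1) *
        ∏ᶠ v : {v : HeightOneSpectrum (𝓞 (Fp L)) // v ∉ T}, Ψv v.1 ((unipDeltaSplit L e dV hdV dW hdW u).2 v.1))
    (hψK : ∀ v, v ∉ T → ∀ k : ↥(unipDeltaLoc L e dV hdV dW hdW v),
      k ∈ inH (fun v => UnitaryGroup.localInt L (IsCMField.complexConj L) (n + n) (hermD L e dV hdV dW hdW) v) (fun v => unipDeltaLoc L e dV hdV dW hdW v) v →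
        Ψv v k = 1)
    (hfT : ∀ u : ↥(unipDelta L e dV hdV dW hdW), f s (weylDelta L e dV hdV dW hdW * (u : HA L e dV hdV dW hdW) * h) =
      FT ((unipDeltaSplit L e dV hdV dW hdW u).1, fun v : T => (unipDeltaSplit L e dV hdV dW hdW u).2 v.1) *
        ∏ᶠ v : {v : HeightOneSpectrum (𝓞 (Fp L)) // v ∉ T}, Λv v.1 ((unipDeltaSplit L e dV hdV dW hdW u).2 v.1))
    (hΛK : ∀ v, v ∉ T → ∀ k : ↥(unipDeltaLoc L e dV hdV dW hdW v),
      k ∈ inH (fun v => UnitaryGroup.localInt L (IsCMField.complexConj L) (n + n) (hermD L e dV hdV dW hdW) v) (fun v => unipDeltaLoc L e dV hdV dW hdW v) v →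
        Λv v k = 1)
    (u : ↥(unipDelta L e dV hdV dW hdW)) :
    conj (unipDeltaChar L e dV hdV dW hdW S (u : HA L e dV hdV dW hdW) : ℂ) * f s (weylDelta L e dV hdV dW hdW * (u : HA L e dV hdV dW hdW) * h) =
      (ΨT ((unipDeltaSplit L e dV hdV dW hdW u).1, fun v : T => (unipDeltaSplit L e dV hdV dW hdW u).2 v.1) *
          FT ((unipDeltaSplit L e dV hdV dW hdW u).1, fun v : T => (unipDeltaSplit L e dV hdV dW hdW u).2 v.1)) *
        ∏ᶠ v : {v : HeightOneSpectrum (𝓞 (Fp L)) // v ∉ T},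
          Ψv v.1 ((unipDeltaSplit L e dV hdV dW hdW u).2 v.1) * Λv v.1 ((unipDeltaSplit L e dV hdV dW hdW u).2 v.1) := by
  -- finite supports of the two restricted tensor factors (no `rw` on the big goal: the head terms are matched structurally)
  have hev : ∀ᶠ v : HeightOneSpectrum (𝓞 (Fp L)) in cofinite,
      (unipDeltaSplit L e dV hdV dW hdW u).2 v ∈
        inH (fun v => UnitaryGroup.localInt L (IsCMField.complexConj L) (n + n) (hermD L e dV hdV dW hdW) v) (fun v => unipDeltaLoc L e dV hdV dW hdW v) v :=
    RestrictedProduct.eventually _ _ _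
  have hfin : ∀ {Φv : ∀ v : HeightOneSpectrum (𝓞 (Fp L)), ↥(unipDeltaLoc L e dV hdV dW hdW v) → ℂ},
      (∀ v, v ∉ T → ∀ k : ↥(unipDeltaLoc L e dV hdV dW hdW v),
        k ∈ inH (fun v => UnitaryGroup.localInt L (IsCMField.complexConj L) (n + n) (hermD L e dV hdV dW hdW) v) (fun v => unipDeltaLoc L e dV hdV dW hdW v) v →
          Φv v k = 1) →
      (Function.mulSupport fun v : {v : HeightOneSpectrum (𝓞 (Fp L)) // v ∉ T} => Φv v.1 ((unipDeltaSplit L e dV hdV dW hdW u).2 v.1)).Finite := by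
    intro Φv hΦ
    refine (Set.Finite.preimage Subtype.val_injective.injOn (Filter.eventually_cofinite.1 hev)).subset ?_
    intro v hv
    simp only [Function.mem_mulSupport] at hv
    simp only [Set.mem_preimage, Set.mem_setOf_eq]
    exact fun hmem => hv (hΦ v.1 v.2 _ hmem)
  refine (congr (congrArg (· * ·) (hψ u)) (hfT u)).trans ?_
  refine (mul_mul_mul_comm _ _ _ _).trans ?_
  congr 1
  exact (finprod_mul_distrib (hfin hψK) (hfin hΛK)).symm

omit [DecidableEq (HeightOneSpectrum (𝓞 (Fp L)))] [MeasurableSpace ↥(unipDelta L e dV hdV dW hdW)] [BorelSpace ↥(unipDelta L e dV hdV dW hdW)]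
  [MeasurableSpace ↥(unipDeltaArch L e dV hdV dW hdW)] [BorelSpace ↥(unipDeltaArch L e dV hdV dW hdW)]
  [∀ v : HeightOneSpectrum (𝓞 (Fp L)), MeasurableSpace ↥(unipDeltaLoc L e dV hdV dW hdW v)] [∀ v : HeightOneSpectrum (𝓞 (Fp L)), BorelSpace ↥(unipDeltaLoc L e dV hdV dW hdW v)] in
/-- **off `T` the local integrand `Ψ_v · Λ_v` is `1` on `K_{H,v} ∩ N_Δ(L⁺_v)`** (both factors are). [cite: KudlaRallis1994, §1] -/
theorem whittakerLocIntegrand_eq_one_of_mem {Ψv Λv : ∀ v : HeightOneSpectrum (𝓞 (Fp L)), ↥(unipDeltaLoc L e dV hdV dW hdW v) → ℂ}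
    (hψK : ∀ v, v ∉ T → ∀ k : ↥(unipDeltaLoc L e dV hdV dW hdW v),
      k ∈ inH (fun v => UnitaryGroup.localInt L (IsCMField.complexConj L) (n + n) (hermD L e dV hdV dW hdW) v) (fun v => unipDeltaLoc L e dV hdV dW hdW v) v →
        Ψv v k = 1)
    (hΛK : ∀ v, v ∉ T → ∀ k : ↥(unipDeltaLoc L e dV hdV dW hdW v),
      k ∈ inH (fun v => UnitaryGroup.localInt L (IsCMField.complexConj L) (n + n) (hermD L e dV hdV dW hdW) v) (fun v => unipDeltaLoc L e dV hdV dW hdW v) v →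
        Λv v k = 1)
    (v : HeightOneSpectrum (𝓞 (Fp L))) (hv : v ∉ T) (k : ↥(unipDeltaLoc L e dV hdV dW hdW v))
    (hk : k ∈ inH (fun v => UnitaryGroup.localInt L (IsCMField.complexConj L) (n + n) (hermD L e dV hdV dW hdW) v) (fun v => unipDeltaLoc L e dV hdV dW hdW v) v) :
    Ψv v k * Λv v k = 1 := by
  rw [hψK v hv k hk, hΛK v hv k hk, one_mul]

/-! ## §2 THE EULER HEAD `W_S(f_s)(h) = W_{S,T}(s) · ∏'_{v∉T} W°_{S,v}(s)` -/

/-- **THE EULER HEAD OF THE TWISTED BIG-CELL INTEGRAL (Φ3d; Φ9 sheet row G1), hypothesis-first.**  Measure letters of ★ Φ3c verbatim (`νN` Haar on `N_Δ(𝔸)`,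
local Haar `ν_v` with `ν_v(K_{H,v} ∩ N_Δ(L⁺_v)) = 1` off `T`, the pinned archimedean factor `ν_∞` and the splitting `hmap` of ★ Φ3b); the two factorisations BY VALUE
(`hψ`∕`hψK` = file (d1), `hfT`∕`hΛK` = file (d2) over ★ #31s) and `G ∈ L¹(νN)` (`hG`, ★ O41.3 `intertwiningConverges` on `re s > n∕2`).  Then
`W_S(f_s)(h) = (∫ ΨT · FT d(ν_∞ ⊗ ⊗_{v∈T} ν_v)) · ∏'_{v∉T} ∫_{N_Δ(L⁺_v)} Ψ_v(y) Λ_v(y) dν_v(y)` — the local factor off `T` being the SPHERICAL local Whittaker coefficient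
`W°_{S,v}(s) = ∫ conj ψ_{S,v}(y) Λ_{s,v}(w_Δ y) dν_v(y)` (its unimodular good-place VALUE: ★ E5∕E7; its Euler product: ★ `K2LiuGoodPlaceWhittakerEulerAssembly`) — together with the
integrability of the transported integrand `(p, y) ↦ [ΨT·FT](p) · ∏ᶠ_{v∉T} Ψ_v(y_v)Λ_v(y_v)` for `(ν_∞ ⊗ ν_T) ⊗ ∏'(ν_v; K∩N_Δ)`.
[cite: KudlaRallis1994, §1–§2] [cite: Tan1999, §2–§3] [cite: CasselsFrohlichANT1967, Ch. XV §3.3 Thm. 3.3.1] [cite: Shimura1997, §18.3] -/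
theorem whittakerDelta_eq_mul_tprod
    (νN : Measure ↥(unipDelta L e dV hdV dW hdW)) (νv : ∀ v : HeightOneSpectrum (𝓞 (Fp L)), Measure ↥(unipDeltaLoc L e dV hdV dW hdW v)) [∀ v, (νv v).IsHaarMeasure]
    [∀ v, SigmaFinite (νv v)]
    (hνK : ∀ v, v ∉ T → νv v (((inH (fun v => UnitaryGroup.localInt L (IsCMField.complexConj L) (n + n) (hermD L e dV hdV dW hdW) v) (fun v => unipDeltaLoc L e dV hdV dW hdW v) v) : Subgroup ↥(unipDeltaLoc L e dV hdV dW hdW v)) : Set ↥(unipDeltaLoc L e dV hdV dW hdW v)) = 1)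
    (νinf : Measure ↥(unipDeltaArch L e dV hdV dW hdW)) [SigmaFinite νinf]
    (hmap : Measure.map (unipDeltaSplitAt L e dV hdV dW hdW T) νN =
      νinf.prod ((Measure.pi fun v : T => νv v.1).prod
        (rpMeasure (fun v : {v : HeightOneSpectrum (𝓞 (Fp L)) // v ∉ T} => ((inH (fun v => UnitaryGroup.localInt L (IsCMField.complexConj L) (n + n) (hermD L e dV hdV dW hdW) v) (fun v => unipDeltaLoc L e dV hdV dW hdW v) v.1 : Subgroup ↥(unipDeltaLoc L e dV hdV dW hdW v.1)) : Set ↥(unipDeltaLoc L e dV hdV dW hdW v.1))) (fun v => νv v.1) ∅)))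
    {f : ℂ → HA L e dV hdV dW hdW → ℂ} (s : ℂ) (S : Matrix (Fin n) (Fin n) L) (h : HA L e dV hdV dW hdW)
    {ΨT FT : ↥(unipDeltaArch L e dV hdV dW hdW) × (Π v : T, ↥(unipDeltaLoc L e dV hdV dW hdW v.1)) → ℂ}
    {Ψv Λv : ∀ v : HeightOneSpectrum (𝓞 (Fp L)), ↥(unipDeltaLoc L e dV hdV dW hdW v) → ℂ}
    (hψ : ∀ u : ↥(unipDelta L e dV hdV dW hdW), conj (unipDeltaChar L e dV hdV dW hdW S (u : HA L e dV hdV dW hdW) : ℂ) =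
      ΨT ((unipDeltaSplit L e dV hdV dW hdW u).1, fun v : T => (unipDeltaSplit L e dV hdV dW hdW u).2 v.1) *
        ∏ᶠ v : {v : HeightOneSpectrum (𝓞 (Fp L)) // v ∉ T}, Ψv v.1 ((unipDeltaSplit L e dV hdV dW hdW u).2 v.1))
    (hψK : ∀ v, v ∉ T → ∀ k : ↥(unipDeltaLoc L e dV hdV dW hdW v),
      k ∈ inH (fun v => UnitaryGroup.localInt L (IsCMField.complexConj L) (n + n) (hermD L e dV hdV dW hdW) v) (fun v => unipDeltaLoc L e dV hdV dW hdW v) v →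
        Ψv v k = 1)
    (hfT : ∀ u : ↥(unipDelta L e dV hdV dW hdW), f s (weylDelta L e dV hdV dW hdW * (u : HA L e dV hdV dW hdW) * h) =
      FT ((unipDeltaSplit L e dV hdV dW hdW u).1, fun v : T => (unipDeltaSplit L e dV hdV dW hdW u).2 v.1) *
        ∏ᶠ v : {v : HeightOneSpectrum (𝓞 (Fp L)) // v ∉ T}, Λv v.1 ((unipDeltaSplit L e dV hdV dW hdW u).2 v.1))
    (hΛK : ∀ v, v ∉ T → ∀ k : ↥(unipDeltaLoc L e dV hdV dW hdW v),
      k ∈ inH (fun v => UnitaryGroup.localInt L (IsCMField.complexConj L) (n + n) (hermD L e dV hdV dW hdW) v) (fun v => unipDeltaLoc L e dV hdV dW hdW v) v →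
        Λv v k = 1)
    (hG : Integrable (fun u : ↥(unipDelta L e dV hdV dW hdW) =>
      conj (unipDeltaChar L e dV hdV dW hdW S (u : HA L e dV hdV dW hdW) : ℂ) * f s (weylDelta L e dV hdV dW hdW * (u : HA L e dV hdV dW hdW) * h)) νN) :
    Integrable (fun z : (↥(unipDeltaArch L e dV hdV dW hdW) × (Π v : T, ↥(unipDeltaLoc L e dV hdV dW hdW v.1))) × (Πʳ v : {v : HeightOneSpectrum (𝓞 (Fp L)) // v ∉ T}, [↥(unipDeltaLoc L e dV hdV dW hdW v.1), inH (fun v => UnitaryGroup.localInt L (IsCMField.complexConj L) (n + n) (hermD L e dV hdV dW hdW) v) (fun v => unipDeltaLoc L e dV hdV dW hdW v) v.1]) =>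
        (ΨT z.1 * FT z.1) * ∏ᶠ v : {v : HeightOneSpectrum (𝓞 (Fp L)) // v ∉ T}, Ψv v.1 (z.2 v) * Λv v.1 (z.2 v))
      ((νinf.prod (Measure.pi fun v : T => νv v.1)).prod (rpMeasure (fun v : {v : HeightOneSpectrum (𝓞 (Fp L)) // v ∉ T} => ((inH (fun v => UnitaryGroup.localInt L (IsCMField.complexConj L) (n + n) (hermD L e dV hdV dW hdW) v) (fun v => unipDeltaLoc L e dV hdV dW hdW v) v.1 : Subgroup ↥(unipDeltaLoc L e dV hdV dW hdW v.1)) : Set ↥(unipDeltaLoc L e dV hdV dW hdW v.1))) (fun v => νv v.1) ∅)) ∧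
    whittakerDelta L e dV hdV dW hdW νN S (f s) h =
      (∫ p, ΨT p * FT p ∂(νinf.prod (Measure.pi fun v : T => νv v.1))) *
        ∏' v : {v : HeightOneSpectrum (𝓞 (Fp L)) // v ∉ T}, ∫ y, Ψv v.1 y * Λv v.1 y ∂(νv v.1) := by
  rw [whittakerDelta_def]
  exact integral_unipDelta_eq_mul_tprod L e dV hdV dW hdW T νN νv hνK νinf hmap _ hG (fun p => ΨT p * FT p) (fun v y => Ψv v y * Λv v y)
    (whittakerIntegrand_eq_mul_finprod L e dV hdV dW hdW T s S h hψ hψK hfT hΛK)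
    (fun v hv k hk => whittakerLocIntegrand_eq_one_of_mem L e dV hdV dW hdW T hψK hΛK v hv k hk)

end Summit.HodgeConjecture.HodgeConjecture.Cruxes.HLiu418.K2LiuWhittakerDeltaEulerHead

end
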